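import Summits.BirchSwinnertonDyer.BirchSwinnertonDyer.Theorems.EisensteinPrimesMazurMCOnCellBTwistbackSubrowPartnerSupplyBRR
import HarnessLib

/-!
# Crux 3 `MazurMCOnCellB` (stmt-BirchSwinnertonDyer-19033), line `twistback` — at a NON-SPLIT odd multiplicative prime
# BOTH characters of every rational `p`-line have modulus `> 1` (ERRATUM IN THE KERNEL to p661987 §1–§4)

Width seat `bsd-line-x2-p1-w8` (g2), cell `bsd-eis`, 2026-08-28. TOOL THEOREMS ONLY (no definition, no named fact, no
`sorry`); every input is a tree THEOREM (Tate uniformisation DISCHARGED: `TateCurve.Silverman1994_thmV53_*_holds`).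
`--supports` stmt-BirchSwinnertonDyer-19033 (helper). No summit statement / Mazur MC / BSD is proved; 0 cells / labels move.

WHY (LEAD g13's caution, bus 2026-08-28T19:39:46Z, conceded): at a prime `p ≠ 2` of NON-split multiplicative reduction
the `G_{ℚ_p}`-module `E[p]` is the unramified-quadratic twist of the Tate extension `0 → μ_p ⊗ χ_nr → E[p] → χ_nr → 0`, so
for ANY rational `p`-line `Φ₀ ≤ E[p]` the line character `φ mod m` and the quotient character `ψ mod d` restrict to
`G_{ℚ_p}` as `{χ_nr, ω·χ_nr}` — both non-trivial. In the tree: w7 g0's `psi_natCast_eq_neg_one_of_not_split` (`ψ(p) = −1`,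
RAMIFIED line, p649032) and `phi_natCast_eq_neg_one_of_not_split_of_lineUnramifiedAt` (`φ(p) = −1`, UNRAMIFIED line,
p650111), and the level divisibilities `p ∣ m` (ramified line) / `p ∣ d` (unramified line) of
`X2.ResidualLineCharacters{,Odd}`. CONSEQUENCE: the sub-cases `d = 1` (trivial quotient character) and `m = 1` (trivial line
character) of this seat's p661987 `…TwistbackSubrowPartnerSupplyBRR` §1–§4 are EMPTY on non-split pairs — those four
theorems are TRUE BUT VACUOUS (their hypotheses `hns` + a level-`1` character are contradictory); only its §0
(`exists_admissible_not_dvd_classNumber`, the admissible `K` with `p ∤ h_K` at every `p > 3`, granted BRR 2022 Thm. 1)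
carries content. This file records the emptiness as theorems, so that no later seat re-aims at the `h_K` sub-cases of
sub-population (iii) of `stub_upperPartnerOffSubrow`:

* §1 `level_quot_ne_one_of_not_split` — `d ≠ 1` for the quotient character of ANY rational `p`-line at a non-split odd
  multiplicative `p` (ramified line: `ψ(p) = −1 ≠ 1 = 𝟙(p)`; unramified line: `p ∣ d`).
* §2 `level_line_ne_one_of_not_split` — `m ≠ 1` for the line character likewise (unramified line: `φ(p) = −1`;
  ramified line: `p ∣ m`).
* §3 `not_exists_lineDatum_trivialChar_of_not_split` — hence NO datum `(Φ₀, φ mod m, ψ mod d)` with `m = 1 ∨ d = 1`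
  exists at a non-split pair: the hypothesis `hbal` of p661987 §4 (and the data of its §1–§3) is unsatisfiable there.

What (iii) really needs at `p ≥ 5` (numbers, unchanged from LEAD g12/g13): with `n = cond` of the unramified character
(`n > 1`, `ψ(p) = −1` resp. `φ(p) = −1`), either `p ∤ h(−n·|d_K|)` for a QUADRATIC character — a supply of imaginary
quadratic `F = ℚ(√(n*·d_K))` RAMIFIED at the primes of `n` in a PRESCRIBED ramified class (finer than Wiles 2015's `S₀`;
outside Beckwith–Raum–Richter 2024 Thm. C, which classifies NON-holomorphic congruences = `S₀ = S₋ = ∅` only), printed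
at `ℓ = 3` only (Nakagawa–Horie–Taya) — or a generalized-Bernoulli unit `‖B_{1,(ψχ_K)⁻¹}‖_p = 1` for a character of
order `≥ 4` (mod-`p` non-vanishing of `L(0, θχ_D)` in residue classes; presearch owed). References:
[GreenbergVatsal2000] §2 pp. 14–15, p. 28; [SilvermanATAEC1994] V.5.2 (c), V.5.3, V.5.4; [NeukirchANT1999] I (10.3), II (9.6).
-/

set_option autoImplicit false

-- `Summit.BirchSwinnertonDyer.BirchSwinnertonDyer.…`: the summit and its single sub-problem share a name.
set_option linter.dupNamespace false

noncomputable section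

open scoped Classical MatrixGroups ModularForm NumberTheorySymbols

open CongruenceSubgroup WeierstrassCurve NumberField IsDedekindDomain Field DirichletCharacter Rat.HeightOneSpectrum
  Literature.NumberTheory.EllipticCurves Literature.NumberTheory.GaloisRepresentations
  Literature.NumberTheory.EllipticCurves.Rank1Residual Literature.NumberTheory.EllipticCurves.Rank1Residual.Typed
  Literature.NumberTheory.EllipticCurves.GreenbergVatsal2000
  Summit.BirchSwinnertonDyer.Rank1Residual Summit.BirchSwinnertonDyer.Rank1Residual.X2
  Summit.BirchSwinnertonDyer.BirchSwinnertonDyer.Theorems.EisensteinPrimesLinePsiAtMultiplicativePrime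
  Summit.BirchSwinnertonDyer.BirchSwinnertonDyer.Theorems.EisensteinPrimesLinePhiAtMultiplicativePrime
  Summit.BirchSwinnertonDyer.Rank1Residual.X2.ResidualLineCharacters
  Summit.BirchSwinnertonDyer.Rank1Residual.X2.ResidualLineCharactersOdd
  Literature.NumberTheory.EllipticCurves.TateCurve

namespace Summit.BirchSwinnertonDyer.BirchSwinnertonDyer.Theorems.EisensteinPrimesMazurMCOnCellBTwistbackNonsplitLineCharactersNontrivial

variable {W : WeierstrassCurve ℚ} [W.IsElliptic] [W.IsGloballyMinimal] {p : ℕ} [hp : Fact p.Prime]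

/-- A character of level `1` takes the value `1` everywhere (every element of `ZMod 1` is a unit). Bookkeeping. [folklore] -/
theorem apply_eq_one_of_level_one (χ : DirichletCharacter (ZMod p) 1) (x : ZMod 1) : χ x = 1 := by
  obtain rfl : χ = 1 := χ.level_one
  exact MulChar.one_apply (isUnit_of_subsingleton x)

omit [W.IsElliptic] [W.IsGloballyMinimal] in
/-- `−1 ≠ 1` in `ZMod p` for an odd prime `p`. Bookkeeping. [folklore] -/
theorem neg_one_ne_one_zmod (hp2 : p ≠ 2) : (-1 : ZMod p) ≠ 1 := by
  intro h
  have h2 : (2 : ZMod p) = 0 := by linear_combination -h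
  have : (p : ℕ) ∣ 2 := by
    rw [show (2 : ZMod p) = ((2 : ℕ) : ZMod p) by norm_cast] at h2
    exact (ZMod.natCast_eq_zero_iff 2 p).mp h2
  exact hp2 ((Nat.prime_dvd_prime_iff_eq hp.out Nat.prime_two).mp this)

/-! ## §1. The QUOTIENT character of a rational line has modulus `> 1` at a non-split prime -/

/-- **`d ≠ 1` for the quotient character at a non-split odd multiplicative prime.** `W/ℚ` globally minimal, `p ≠ 2` of
NON-split multiplicative reduction, `Φ₀` ANY rational `p`-line, `ψ mod d` a character with `σ • P − ψ(χ_d σ) • P ∈ Φ₀` on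
`E[p]`: then `d ≠ 1`. Ramified line: `ψ(p) = −1` (w7 g0 `psi_natCast_eq_neg_one_of_not_split`, Greenberg–Vatsal's «ψ is the
unramified quadratic character at a non-split prime»), whereas a level-`1` character is `1` at `p`; unramified line: `p ∣ d`
(`ResidualLineCharactersOdd.dvd_level_quot_of_lineUnramifiedAt`, the quotient is then the ramified Tate character).
Primitivity of `ψ` is not needed. [cite: GreenbergVatsal2000, §2 pp. 14–15 and p. 28]
[cite: SilvermanATAEC1994, Ch. V Lemma 5.2 (c), Thm. 5.3, Cor. 5.4] -/
theorem level_quot_ne_one_of_not_split (hp2 : p ≠ 2) (hmult : W.HasMultiplicativeReductionAtPrime p)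
    (hns : ¬ W.HasSplitMultiplicativeReductionAtPrime p)
    {Φ₀ : AddSubgroup (geomTorsion W (p : ℤ))} (hΦ : IsRationalLine W p Φ₀)
    {d : ℕ} [NeZero d] (ψ : DirichletCharacter (ZMod p) d)
    (hψ0 : ∀ (σ : absoluteGaloisGroup ℚ) (P : geomTorsion W (p : ℤ)),
      σ • P - (ψ ((modNCyclotomicCharacter ℚ d σ : (ZMod d)ˣ) : ZMod d)).val • P ∈ Φ₀) :
    d ≠ 1 := by
  rintro rfl
  by_cases hunr : LineUnramifiedAt W p Φ₀
  · have hTate := IsogenyLineType.exists_tateLine_adicCompletionPrime W p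
      Silverman1994_thmV53_tateUniformisation_holds Silverman1994_thmV53_corV54_tateUniformisation_holds hp2 hmult
    exact hp.out.not_dvd_one (ResidualLineCharactersOdd.dvd_level_quot_of_lineUnramifiedAt hΦ hTate hunr hψ0)
  · exact psi_natCast_ne_one_of_not_split hp2 hmult hns hΦ hunr ψ hp.out.not_dvd_one hψ0
      (apply_eq_one_of_level_one ψ _)

/-! ## §2. The LINE character of a rational line has modulus `> 1` at a non-split prime -/

/-- **`m ≠ 1` for the line character at a non-split odd multiplicative prime.** Same setting, `φ mod m` a character with
`σ • P = φ(χ_m σ) • P` on `Φ₀`: then `m ≠ 1` — i.e. `Φ₀` is NOT pointwise rational (no rational point of order `p` spans a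
line at a non-split prime; consistent with `#Ẽ_ns(𝔽_p) = p + 1`, `c_p ≤ 2`). Unramified line: `φ(p) = −1 ≠ 1` (w7 g0
`phi_natCast_eq_neg_one_of_not_split_of_lineUnramifiedAt`); ramified line: `p ∣ m`
(`ResidualLineCharacters.dvd_level_of_not_lineUnramifiedAt`). [cite: GreenbergVatsal2000, §2 pp. 14–15 and p. 28]
[cite: SilvermanATAEC1994, Ch. V Lemma 5.2 (c), Thm. 5.3, Cor. 5.4] -/
theorem level_line_ne_one_of_not_split (hp2 : p ≠ 2) (hmult : W.HasMultiplicativeReductionAtPrime p)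
    (hns : ¬ W.HasSplitMultiplicativeReductionAtPrime p)
    {Φ₀ : AddSubgroup (geomTorsion W (p : ℤ))} (hΦ : IsRationalLine W p Φ₀)
    {m : ℕ} [NeZero m] (φ : DirichletCharacter (ZMod p) m)
    (hφ0 : ∀ (σ : absoluteGaloisGroup ℚ), ∀ P ∈ Φ₀,
      σ • P = (φ ((modNCyclotomicCharacter ℚ m σ : (ZMod m)ˣ) : ZMod m)).val • P) :
    m ≠ 1 := by
  rintro rfl
  by_cases hunr : LineUnramifiedAt W p Φ₀
  · have h := phi_natCast_eq_neg_one_of_not_split_of_lineUnramifiedAt hp2 hmult hns hΦ hunr φ hp.out.not_dvd_one hφ0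
    rw [apply_eq_one_of_level_one φ _] at h
    exact neg_one_ne_one_zmod hp2 h.symm
  · have hTate := IsogenyLineType.exists_tateLine_adicCompletionPrime W p
      Silverman1994_thmV53_tateUniformisation_holds Silverman1994_thmV53_corV54_tateUniformisation_holds hp2 hmult
    exact hp.out.not_dvd_one (ResidualLineCharacters.dvd_level_of_not_lineUnramifiedAt hΦ hTate hunr hφ0)

/-! ## §3. Hence NO line datum with a trivial character exists at a non-split pair (p661987 §1–§4 are vacuous) -/

/-- **No rational `p`-line datum with `m = 1 ∨ d = 1` at a non-split odd multiplicative prime.** The existential that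
p661987 §4 (`…SubrowPartnerSupplyBRR.upperPartner_at_of_balanceOne_trivialChar_of_brr2022_of_thmE`) takes as hypothesis —
already without its primitivity, `S₀` and balance clauses — is FALSE whenever `p ≠ 2` is a prime of non-split multiplicative
reduction: by §1 and §2. So the `h_K` sub-cases of sub-population (iii) of `stub_upperPartnerOffSubrow` are empty; the class
number in LEAD g11's `K`-given doors is `h(−n·|d_K|)` with `n > 1` on every non-split pair (erratum to this seat's p661987,
whose §0 alone carries content). [cite: GreenbergVatsal2000, §2 pp. 14–15 and p. 28] -/
theorem not_exists_lineDatum_trivialChar_of_not_split (hp2 : p ≠ 2) (hmult : W.HasMultiplicativeReductionAtPrime p)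
    (hns : ¬ W.HasSplitMultiplicativeReductionAtPrime p) :
    ¬ ∃ (Φ₀ : AddSubgroup (geomTorsion W (p : ℤ))) (m : ℕ) (_ : NeZero m) (φ : DirichletCharacter (ZMod p) m)
        (d : ℕ) (_ : NeZero d) (ψ : DirichletCharacter (ZMod p) d),
      (m = 1 ∨ d = 1) ∧ IsRationalLine W p Φ₀ ∧
      (∀ (σ : absoluteGaloisGroup ℚ), ∀ P ∈ Φ₀,
        σ • P = (φ ((modNCyclotomicCharacter ℚ m σ : (ZMod m)ˣ) : ZMod m)).val • P) ∧
      (∀ (σ : absoluteGaloisGroup ℚ) (P : geomTorsion W (p : ℤ)),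
        σ • P - (ψ ((modNCyclotomicCharacter ℚ d σ : (ZMod d)ˣ) : ZMod d)).val • P ∈ Φ₀) := by
  rintro ⟨Φ₀, m, im, φ, d, id, ψ, htriv, hΦ, hφ0, hψ0⟩
  rcases htriv with hm | hd
  · exact level_line_ne_one_of_not_split hp2 hmult hns hΦ φ hφ0 hm
  · exact level_quot_ne_one_of_not_split hp2 hmult hns hΦ ψ hψ0 hd

/-- **The same on an X2b pair**: for `X2.CellB W p` (so `p ≠ 2`, `p` multiplicative) non-split at `p`, the hypothesis
`hbal` of p661987 §4 is unsatisfiable — its conclusion there is obtained from `False`. Stated with that hypothesis VERBATIM.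
[cite: GreenbergVatsal2000, §2 pp. 14–15 and p. 28] -/
theorem not_balanceOne_trivialChar_of_cellB_of_not_split (hc : X2.CellB W p)
    (hns : ¬ W.HasSplitMultiplicativeReductionAtPrime p) :
    ¬ ∃ (Φ₀ : AddSubgroup (geomTorsion W (p : ℤ))) (m : ℕ) (_ : NeZero m) (φ : DirichletCharacter (ZMod p) m)
        (d : ℕ) (_ : NeZero d) (ψ : DirichletCharacter (ZMod p) d) (S₀ : Finset (HeightOneSpectrum (𝓞 ℚ))),
      (m = 1 ∨ d = 1) ∧ IsRationalLine W p Φ₀ ∧ φ.IsPrimitive ∧ ψ.IsPrimitive ∧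
      (∀ (σ : absoluteGaloisGroup ℚ), ∀ P ∈ Φ₀,
        σ • P = (φ ((modNCyclotomicCharacter ℚ m σ : (ZMod m)ˣ) : ZMod m)).val • P) ∧
      (∀ (σ : absoluteGaloisGroup ℚ) (P : geomTorsion W (p : ℤ)),
        σ • P - (ψ ((modNCyclotomicCharacter ℚ d σ : (ZMod d)ˣ) : ZMod d)).val • P ∈ Φ₀) ∧
      (∀ v ∈ S₀, ((p : ℕ) : 𝓞 ℚ) ∉ v.asIdeal) ∧
      (∀ v : HeightOneSpectrum (𝓞 ℚ), v ∉ S₀ → ((p : ℕ) : 𝓞 ℚ) ∉ v.asIdeal → W.HasGoodReductionAt v) ∧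
      1 + ∑ v ∈ S₀, delta W p v =
        ∑ v ∈ S₀, ((if φ (Rat.HeightOneSpectrum.natGenerator v : ZMod m) =
              (Rat.HeightOneSpectrum.natGenerator v : ZMod p)
            then sFactor p (Rat.HeightOneSpectrum.natGenerator v) else 0) +
          (if ψ (Rat.HeightOneSpectrum.natGenerator v : ZMod d) =
              (Rat.HeightOneSpectrum.natGenerator v : ZMod p)
            then sFactor p (Rat.HeightOneSpectrum.natGenerator v) else 0)) := by
  rintro ⟨Φ₀, m, im, φ, d, id, ψ, S₀, htriv, hΦ, -, -, hφ0, hψ0, -⟩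
  exact not_exists_lineDatum_trivialChar_of_not_split hc.2.1.1 hc.2.1.2.2 hns
    ⟨Φ₀, m, im, φ, d, id, ψ, htriv, hΦ, hφ0, hψ0⟩

end Summit.BirchSwinnertonDyer.BirchSwinnertonDyer.Theorems.EisensteinPrimesMazurMCOnCellBTwistbackNonsplitLineCharactersNontrivial

end
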